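import Literature.NumberTheory.EllipticCurves.BSDSelmerCMPConverseCMFieldTwistFamily
import Literature.NumberTheory.EllipticCurves.Selmer
import Literature.NumberTheory.EllipticCurves.AnalyticRank
import HarnessLib

/-!
# Proportions of rank-`0` / rank-`1` quadratic twists of the curve `19a3` (`y² + y = x³ + x² + x`):
# Bhargava–Klagsbrun–Lemke Oliver–Shnidman 2019 (REFEREED: `≥ 25%` rank `0`, `≥ 41.6̄%` `3`-Selmer rank `1`)
# and Keller–Yin 2024b, Cor. 3.8.1 (PREPRINT CLAIM: `≥ 5/12` + `1/4 = 2/3` of the twists have `rk E_d(ℚ) = ord_{s=1} L(E_d, s)`)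

Cell `bsd-littype` (cross-ladder literature-typing layer, D-0088(4)), seat `bsd-littype-06` (gen-2
successor; HOME `run/shared/lean/pub/bsd-littype/`, OPEN-QUESTIONS-06 Q-A7). Honest framing (cell,
verbatim): "no tranche here proves BSD … typed ≠ proved ≠ endorsed". This file vendors TWO printed
statements about ONE family — the quadratic twists of the elliptic curve with Cremona label `19a3` —
in the tree's EXISTING vocabulary for "at least a proportion `δ` of the square classes
`t ∈ K^×/(K^×)²` ordered by the BKLOS height" (`SquareClassProportionGe`, `TwistClassSatisfies`,
`squareClassHeight`, file `BSDSelmerCMPConverseCMFieldTwistFamily.lean`, typed for Burungale–Tian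
2026 Thm. 3.5 = BKLOS Thm. 2.7), here at `K = ℚ` (square classes = squarefree `d ∈ ℤ ∖ {0}`,
`H(d) = |d|`):

1. `cremona19a3 : WeierstrassCurve ℚ := ⟨0, 1, 1, 1, 0⟩` — the curve "`E : y² + y = x³ + x² + x`
   having Cremona label 19a3" (BKLOS §2, verbatim below), with `Δ = −19`, `j = 2¹⁵/19`, elliptic
   (PROVED by `norm_num`); a DEFINITION with a body.
2. `BhargavaKlagsbrunLemkeOliverShnidman2019.cremona19a3_rankZero_selmerRankOne_proportions` —
   **REFEREED** (Duke Math. J. 168 (2019) 2951–2989 = arXiv:1709.09790, §2, the paragraph after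
   Thm. 2.6, held LaTeXML text `paper:arxiv-1709.09790` chunk p0005 L40–L41, verbatim): "The
   proportions provided by Theorem 2.5 will naturally be largest when every `s ∈ F^*/F^{*2}` is
   either in `T_0(φ)` or `T_1(φ)`. The elliptic curve of smallest conductor over `ℚ` for which this
   occurs is the curve `E : y² + y = x³ + x² + x` having Cremona label 19a3. Since the parity of
   `t(φ_s)` is easily seen to be equidistributed in quadratic twist families over `ℚ`, we deduce
   that, in this special situation, half of the squareclasses lie in `T_0(φ)` and half lie in
   `T_1(φ)`. Thus, by Theorem 2.4, the average rank of `E_s` is at most `7/6`, and, by Theorem 2.5,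
   at least `25%` of twists `E_s` have rank `0` and at least `41.6%` [= `(5/6)·(1/2) = 5/12`] have
   `3`-Selmer rank `1`." (Thm. 2.5, p0005 L16–L23: "(a) The proportion of twists `E_s` having rank
   `0` is at least `½ μ(T_0(φ))`; (b) the proportion of twists `E_s` having `3`-Selmer rank `1` is at
   least `⅚ μ(T_1(φ))`"; "`3`-Selmer rank" = `dim_{𝔽₃} Sel_3(E_s)`, proof of Thm. 2.5, p0014 L43–L47.)
   Transcribed: rank `0` ↦ `E.mordellWeilRank = 0`; `3`-Selmer rank `1` ↦ `#Sel^{(3)}(E_s/ℚ) = 3`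
   (`Nat.card (E.selmerGroup 3) = 3`, the currency of `Sakamoto2024.card_selmerGroup_three_eq_…`);
   "at least `25%` / `41.6̄%` of twists" ↦ `SquareClassProportionGe … (1/4)` / `(5/12)` (lower
   proportion, BKLOS height ordering — exactly as `burungaleTian_thm35_selmerCorank_three_twists`).
   The average-rank clause "at most `7/6`" is NOT transcribed (no square-class average in the tree).
3. `KellerYin2024.cor381_cremona19a3_twists_OPEN` — **UNREFEREED PREPRINT CLAIM** (T. Keller,
   M. Yin, arXiv:2410.23241v1, Cor. 3.8.1, held text `paper:arxiv-2410.23241` chunk p0021 L53–L62,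
   verbatim): "We can obtain better proportions of quadratic twists of (algebraic and analytic) rank
   `1` in [BKLOS] for a fixed elliptic curve, in particular a lower bound of `5/12 = 41.66…%` in the
   most advantageous cases (for example, when it's the curve having Cremona label `19a3`). For the
   twists `E_d` of the curve `E = 19a3`, earlier results in [CGLS] and [KY24] only apply when
   `d ≡ 1, 2 (mod 3)`, covering at least `3/8 + 3/8 = 3/4` of the proportion of the `3`-Selmer rank
   `1` twists. Our result also cover the twists with `d ≡ 0 (mod 3)` (`2/8` of all) that correspond
   to additive reduction (necessarily potentially good ordinary because the original curve is).
   Consequently, in this family, all curves with `3`-Selmer ranks `0` or `1` have algebraic and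
   analytic rank equal to the `3`-Selmer ranks, so at least `5/12` (rank `1`) `+ 1/4` (rank `0`)
   `= 2/3` twists satisfy the BSD rank c‑nj." [the source's last word, spelled out, is reserved by
   the gate lint `literature.c…` for `Summits/` obligation leaves; it means `rk = ord_{s=1} L`].
   Transcribed as the conjunction of (A) the
   pointwise clause — every quadratic twist `E_d` (`d ∈ ℚ^×`) with `3`-Selmer rank `r ∈ {0,1}` has
   `rk E_d(ℚ) = r` and `ord_{s=1} L(E_d, s) = r`, where "`3`-Selmer rank" is READ IN THE CURRENCY OF
   THE THEOREM THE COROLLARY APPLIES, Thm. 3.7.1: `corank_{ℤ₃} Sel_{3^∞}(E_d/ℚ)` (`selmerCorank`; with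
   BKLOS's `dim_{𝔽₃} Sel_3` the pointwise sentence would FAIL at the square class of `d = 1`, where
   `E_1 = E` has `rk E(ℚ) = 0` but `dim_{𝔽₃} Sel_3(E/ℚ) ≥ 1` from the rational `3`-torsion; the two
   readings agree whenever `E_d(ℚ)[3] = 0` and `Ш(E_d)[3^∞]` is finite, by Cassels–Tate parity — a
   step the printed proof leaves implicit, recorded on HOME/OPEN-QUESTIONS-06) — and (B) the three
   proportions (`≥ 5/12` with algebraic AND analytic rank `1`; `≥ 1/4` with both `0`; `≥ 2/3` with
   `rk = ord_{s=1} L`), exactly as printed. Inputs of the printed proof: BKLOS (item 2), the `p = 3`-converse theorems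
   CGLS 2022 Thm. E / [KY24] (good reduction at `3`, `3 ∤ d`) and Keller–Yin Thm. 3.7.1 = 0.1.2
   (additive potentially good ordinary at `3`, `3 ∣ d`; tree claim
   `KellerYin2024.thm012_analyticRank_eq_of_selmerCorank_eq`, here inside its printed-proof scope
   Case (I), `e = 2`), `3`-parity/Cassels for `dim Sel_3 ⇒ corank Sel_{3^∞}`, Gross–Zagier–Kolyvagin.
   `[claim: KellerYin2024PotOrd, status: under-review]`, suffix `_OPEN`, no `_holds`.

PROVED (bookkeeping only): `Δ = −19`, `c₄ = −32` (so `j = c₄³/Δ = 2¹⁵/19`), ellipticity of the model; `TwistClassSatisfies.mono`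
(pointwise implication transports along a square class); from (A) of the claim, every square class
of `3^∞`-Selmer corank `1` twists is a class of algebraic-and-analytic rank `1` twists
(`twistClassSatisfies_rank_one_of_cor381_OPEN`). The passage from item 2 (b) to the `5/12` clause of
item 3 (B) additionally needs the parity bridge `dim_{𝔽₃} Sel_3 = 1 ⇒ corank_{ℤ₃} Sel_{3^∞} = 1`
(off the finitely many classes with rational `3`-torsion) and monotonicity of
`SquareClassProportionGe` (finiteness of the height balls of `ℚ^×/(ℚ^×)²`), neither in the tree; it
is therefore NOT asserted as a theorem here (the `5/12` clause is part of the claim as printed). Nothing else is minted: net +2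
named statements (one REFEREED fact, one claim).

## References
* [BhargavaKlagsbrunLemkeOliverShnidman2019] M. Bhargava, Z. Klagsbrun, R. J. Lemke Oliver,
  A. Shnidman, Duke Math. J. 168 (2019) 2951–2989 = arXiv:1709.09790: §2 (height, Thms. 2.4–2.6 and
  the `19a3` paragraph, chunk p0005 L10–L41), proof of Thm. 2.5 (§5, chunk p0014 L43–L47).
* [KellerYin2024PotOrd] T. Keller, M. Yin, arXiv:2410.23241v1: Cor. 3.8.1 (§3.8, chunk p0021 L53–L62),
  Thm. 3.7.1 (p0021 L39–L47).
* [BurungaleTian2026] Ann. of Math. 203 (2026): Thm. 3.5 (the tree's `SquareClassProportionGe` /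
  `TwistClassSatisfies` vocabulary, file `BSDSelmerCMPConverseCMFieldTwistFamily.lean`).
* [Cremona1997] J. E. Cremona, *Algorithms for modular elliptic curves*, Table 1, `N = 19`:
  `19a3 = [0, 1, 1, 1, 0]` (coefficients as printed by BKLOS).
-/

noncomputable section

open scoped Classical

open WeierstrassCurve

namespace Literature.NumberTheory.EllipticCurves

/-! ### §1 The curve `19a3` -/

/-- **The elliptic curve `19a3`**: `y² + y = x³ + x² + x`, i.e. `[a₁, a₂, a₃, a₄, a₆] = [0, 1, 1, 1, 0]`
("the curve `E : y² + y = x³ + x² + x` having Cremona label 19a3", BKLOS §2, p0005 L40; the example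
curve of Keller–Yin Cor. 3.8.1). Conductor `19`, `Δ = −19`, `j = 2¹⁵/19`, rational `3`-torsion
(`(0,0)` has order `3`), hence a rational `3`-isogeny; `a₃ = −2`, so `3` is a prime of good
ORDINARY reduction. A definition. [cite: BhargavaKlagsbrunLemkeOliverShnidman2019, §2 (paragraph after Thm. 2.6; chunk p0005 L40)] -/
def cremona19a3 : WeierstrassCurve ℚ := ⟨0, 1, 1, 1, 0⟩

/-- `Δ(19a3) = −19`. [cite: BhargavaKlagsbrunLemkeOliverShnidman2019, §2 (the curve 19a3)] -/
theorem cremona19a3_Δ : cremona19a3.Δ = -19 := by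
  norm_num [cremona19a3, WeierstrassCurve.Δ, WeierstrassCurve.b₂, WeierstrassCurve.b₄,
    WeierstrassCurve.b₆, WeierstrassCurve.b₈]

/-- `c₄(19a3) = −32`. [cite: BhargavaKlagsbrunLemkeOliverShnidman2019, §2 (the curve 19a3)] -/
theorem cremona19a3_c₄ : cremona19a3.c₄ = -32 := by
  norm_num [cremona19a3, WeierstrassCurve.c₄, WeierstrassCurve.b₂, WeierstrassCurve.b₄]

/-- `19a3` is an elliptic curve (`Δ = −19 ≠ 0`). A theorem, deliberately not an `instance`
(typer lint); use `haveI := cremona19a3_isElliptic`. [cite: BhargavaKlagsbrunLemkeOliverShnidman2019, §2 (the curve 19a3)] -/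
theorem cremona19a3_isElliptic : cremona19a3.IsElliptic := by
  rw [WeierstrassCurve.isElliptic_iff, cremona19a3_Δ, isUnit_iff_ne_zero]
  norm_num

/-! ### §2 Transport of pointwise implications along square classes (API of `TwistClassSatisfies`) -/

/-- A pointwise implication between properties of curves transports along every square class.
[cite: BurungaleTian2026, Prop. 1.3 (the twists `E^{(t)}`)] -/
theorem TwistClassSatisfies.mono {K : Type*} [Field K] {V : WeierstrassCurve K}
    {P Q : WeierstrassCurve K → Prop} (hPQ : ∀ E : WeierstrassCurve K, P E → Q E)
    {t : SquareClass K} (h : TwistClassSatisfies V P t) : TwistClassSatisfies V Q t :=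
  fun s hs ↦ hPQ _ (h s hs)

/-! ### §3 BKLOS 2019, §2: the `19a3` proportions — REFEREED named fact -/

namespace BhargavaKlagsbrunLemkeOliverShnidman2019

/-- **Bhargava–Klagsbrun–Lemke Oliver–Shnidman, Duke Math. J. 168 (2019), §2 (paragraph after
Thm. 2.6; from Thm. 2.5 with `μ(T_0(φ)) = μ(T_1(φ)) = ½` for `19a3`)**, verbatim: "by Theorem 2.5,
at least `25%` of twists `E_s` have rank `0` and at least `41.6%` have `3`-Selmer rank `1`" for
"the curve `E : y² + y = x³ + x² + x` having Cremona label 19a3" (`41.6%` = `41.6̄% = ⅚·½ = 5/12`,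
Thm. 2.5 (b)). Transcription: square classes `t ∈ ℚ^×/(ℚ^×)²` ordered by the BKLOS height
(`SquareClassProportionGe`, lower proportion `liminf ≥ δ`), the twist property for every
representative (`TwistClassSatisfies`); "rank `0`" = `E.mordellWeilRank = 0`; "`3`-Selmer rank
`1`" = `dim_{𝔽₃} Sel_3(E_s/ℚ) = 1` (proof of Thm. 2.5, p0014 L43–L47) = `#Sel^{(3)}(E_s/ℚ) = 3`.
The clause "the average rank of `E_s` is at most `7/6`" (Thm. 2.4) is not transcribed. REFEREED.
No `_holds` expected (geometry-of-numbers count of `Sel_φ`, Cassels' parity).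
[cite: BhargavaKlagsbrunLemkeOliverShnidman2019, §2 paragraph after Thm. 2.6 (chunk p0005 L40–L41) with Thm. 2.5 (p0005 L16–L23)] -/
def cremona19a3_rankZero_selmerRankOne_proportions : Prop :=
  SquareClassProportionGe
      (TwistClassSatisfies cremona19a3 fun E : WeierstrassCurve ℚ ↦ E.mordellWeilRank = 0) (1 / 4) ∧
    SquareClassProportionGe
      (TwistClassSatisfies cremona19a3 fun E : WeierstrassCurve ℚ ↦ Nat.card (E.selmerGroup 3) = 3)
      (5 / 12)

/-- The rank-`0` clause: at least `25%` of the quadratic twists of `19a3` have Mordell–Weil rank `0`.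
[cite: BhargavaKlagsbrunLemkeOliverShnidman2019, §2 paragraph after Thm. 2.6 (chunk p0005 L41)] -/
theorem proportion_rank_zero_ge_quarter (h : cremona19a3_rankZero_selmerRankOne_proportions) :
    SquareClassProportionGe
      (TwistClassSatisfies cremona19a3 fun E : WeierstrassCurve ℚ ↦ E.mordellWeilRank = 0) (1 / 4) :=
  h.1

/-- The `3`-Selmer clause: at least `5/12` of the quadratic twists of `19a3` have `#Sel^{(3)} = 3`.
[cite: BhargavaKlagsbrunLemkeOliverShnidman2019, §2 paragraph after Thm. 2.6 (chunk p0005 L41)] -/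
theorem proportion_card_selmerGroup_three_eq_three_ge (h : cremona19a3_rankZero_selmerRankOne_proportions) :
    SquareClassProportionGe
      (TwistClassSatisfies cremona19a3 fun E : WeierstrassCurve ℚ ↦ Nat.card (E.selmerGroup 3) = 3)
      (5 / 12) :=
  h.2

end BhargavaKlagsbrunLemkeOliverShnidman2019

/-! ### §4 Keller–Yin 2024b, Cor. 3.8.1 — PREPRINT CLAIM (`_OPEN`) -/

namespace KellerYin2024

/-- **OPEN HYPOTHESIS — UNREFEREED PREPRINT (Keller–Yin, arXiv:2410.23241v1), Corollary 3.8.1, for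
the curve `19a3`** (verbatim in the module docstring; p0021 L53–L62): (A) "in this family, all
curves with `3`-Selmer ranks `0` or `1` have algebraic and analytic rank equal to the `3`-Selmer
ranks" — for every `d ∈ ℚ^×` and `r ∈ {0,1}`, `corank_{ℤ₃} Sel_{3^∞}(E_d/ℚ) = r` implies
`rk E_d(ℚ) = r` and `ord_{s=1} L(E_d,s) = r`, `E_d = cremona19a3.quadraticTwist d` ("`3`-Selmer
rank" read as the `3^∞`-Selmer corank, the currency of Thm. 3.7.1 which the corollary applies — see
the module docstring for why the `dim_{𝔽₃} Sel_3` reading would be false at `d = 1`); (B) "so at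
least `5/12` (rank `1`) `+ 1/4` (rank `0`) `= 2/3` twists satisfy the BSD rank c‑nj." [i.e. have
`rk E_d(ℚ) = ord_{s=1} L(E_d,s)`] — lower
proportions (BKLOS height ordering, `SquareClassProportionGe` / `TwistClassSatisfies`) `≥ 5/12` of
square classes with algebraic AND analytic rank `1`, `≥ 1/4` with both `0`, `≥ 2/3` with
`rk E_d(ℚ) = ord_{s=1} L(E_d,s)`. Printed proof: BKLOS §2 (tree fact
`BhargavaKlagsbrunLemkeOliverShnidman2019.cremona19a3_rankZero_selmerRankOne_proportions`) + the
`3`-converse theorems (CGLS 2022 Thm. E / [KY24] at `3 ∤ d`; Thm. 3.7.1 = 0.1.2, tree claim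
`thm012_analyticRank_eq_of_selmerCorank_eq`, at `3 ∣ d`, where `E_d` is additive potentially good
ordinary at `3` with `e = 2`, inside the printed proof's Case (I)) + Gross–Zagier–Kolyvagin. NEVER
cite this `Prop` as a theorem; conditional on two preprint layers ([KY24], this paper).
[claim: KellerYin2024PotOrd, status: under-review]
[cite: BhargavaKlagsbrunLemkeOliverShnidman2019, §2 paragraph after Thm. 2.6 (the input; chunk p0005 L40–L41)] -/
def cor381_cremona19a3_twists_OPEN : Prop :=
  (∀ (d : ℚ), d ≠ 0 → ∀ r : ℕ, r = 0 ∨ r = 1 →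
      (cremona19a3.quadraticTwist d).selmerCorank 3 = r →
        (cremona19a3.quadraticTwist d).mordellWeilRank = r ∧
          (cremona19a3.quadraticTwist d).analyticRank = r) ∧
    SquareClassProportionGe
        (TwistClassSatisfies cremona19a3 fun E : WeierstrassCurve ℚ ↦
          E.mordellWeilRank = 1 ∧ E.analyticRank = 1) (5 / 12) ∧
      SquareClassProportionGe
          (TwistClassSatisfies cremona19a3 fun E : WeierstrassCurve ℚ ↦
            E.mordellWeilRank = 0 ∧ E.analyticRank = 0) (1 / 4) ∧
        SquareClassProportionGe
          (TwistClassSatisfies cremona19a3 fun E : WeierstrassCurve ℚ ↦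
            E.mordellWeilRank = E.analyticRank) (2 / 3)

/-- **Clause (A) at corank `1`, pointwise**: granted the claim, a quadratic twist `E_d` of `19a3`
with `corank_{ℤ₃} Sel_{3^∞}(E_d/ℚ) = 1` has algebraic and analytic rank `1`. Bookkeeping; conditional
on the claim. [claim: KellerYin2024PotOrd, status: under-review] -/
theorem rank_one_of_selmerCorank_three_eq_one_of_cor381_OPEN
    (h : cor381_cremona19a3_twists_OPEN) {d : ℚ} (hd : d ≠ 0)
    (h1 : (cremona19a3.quadraticTwist d).selmerCorank 3 = 1) :
    (cremona19a3.quadraticTwist d).mordellWeilRank = 1 ∧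
      (cremona19a3.quadraticTwist d).analyticRank = 1 :=
  h.1 d hd 1 (Or.inr rfl) h1

/-- **Clause (A) at corank `0`, pointwise**: granted the claim, a quadratic twist `E_d` of `19a3`
with `corank_{ℤ₃} Sel_{3^∞}(E_d/ℚ) = 0` has algebraic and analytic rank `0`. Bookkeeping; conditional
on the claim. [claim: KellerYin2024PotOrd, status: under-review] -/
theorem rank_zero_of_selmerCorank_three_eq_zero_of_cor381_OPEN
    (h : cor381_cremona19a3_twists_OPEN) {d : ℚ} (hd : d ≠ 0)
    (h0 : (cremona19a3.quadraticTwist d).selmerCorank 3 = 0) :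
    (cremona19a3.quadraticTwist d).mordellWeilRank = 0 ∧
      (cremona19a3.quadraticTwist d).analyticRank = 0 :=
  h.1 d hd 0 (Or.inl rfl) h0

/-- **Every square class of `3^∞`-Selmer-corank-`1` twists of `19a3` is a class of
algebraic-and-analytic-rank-`1` twists** (clause (A) transported along a class by
`TwistClassSatisfies.mono`; the representatives `s ∈ ℚ^×` are nonzero). Conditional on the claim;
nothing asserted. [claim: KellerYin2024PotOrd, status: under-review] -/
theorem twistClassSatisfies_rank_one_of_cor381_OPEN (h : cor381_cremona19a3_twists_OPEN)
    {t : SquareClass ℚ}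
    (ht : TwistClassSatisfies cremona19a3
      (fun E : WeierstrassCurve ℚ ↦ E.selmerCorank 3 = 1) t) :
    TwistClassSatisfies cremona19a3
      (fun E : WeierstrassCurve ℚ ↦ E.mordellWeilRank = 1 ∧ E.analyticRank = 1) t :=
  fun s hs ↦ rank_one_of_selmerCorank_three_eq_one_of_cor381_OPEN h s.ne_zero (ht s hs)

/-- The same at corank `0`. [claim: KellerYin2024PotOrd, status: under-review] -/
theorem twistClassSatisfies_rank_zero_of_cor381_OPEN (h : cor381_cremona19a3_twists_OPEN)
    {t : SquareClass ℚ}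
    (ht : TwistClassSatisfies cremona19a3
      (fun E : WeierstrassCurve ℚ ↦ E.selmerCorank 3 = 0) t) :
    TwistClassSatisfies cremona19a3
      (fun E : WeierstrassCurve ℚ ↦ E.mordellWeilRank = 0 ∧ E.analyticRank = 0) t :=
  fun s hs ↦ rank_zero_of_selmerCorank_three_eq_zero_of_cor381_OPEN h s.ne_zero (ht s hs)

/-- The proportion clauses of the claim, isolated: `≥ 5/12` of the quadratic twists of `19a3`
(BKLOS ordering) have algebraic and analytic rank `1`, `≥ 1/4` have both `0`, `≥ 2/3` satisfy the
rank part of BSD `rk = ord_{s=1} L`. Conditional on the claim. [claim: KellerYin2024PotOrd, status: under-review] -/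
theorem proportions_of_cor381_OPEN (h : cor381_cremona19a3_twists_OPEN) :
    SquareClassProportionGe
        (TwistClassSatisfies cremona19a3 fun E : WeierstrassCurve ℚ ↦
          E.mordellWeilRank = 1 ∧ E.analyticRank = 1) (5 / 12) ∧
      SquareClassProportionGe
          (TwistClassSatisfies cremona19a3 fun E : WeierstrassCurve ℚ ↦
            E.mordellWeilRank = 0 ∧ E.analyticRank = 0) (1 / 4) ∧
        SquareClassProportionGe
          (TwistClassSatisfies cremona19a3 fun E : WeierstrassCurve ℚ ↦
            E.mordellWeilRank = E.analyticRank) (2 / 3) :=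
  h.2

end KellerYin2024

end Literature.NumberTheory.EllipticCurves

end
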